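import Literature.MathematicalPhysics.QuantumFieldTheory.Balaban1983to89.B8BlockConstantLiftStabilityRec

/-!
# `Balaban1983to89.B8Prop6OfThm4PrecomposedRec` — [Balaban1985RegularSpaces] p. 99 «the assumptions of Theorem 4 are satisfied for the pair of configurations 1, U₀″» WITH THE
# INPUT PRE-COMPOSED BY A GAUGE TRANSFORMATION CONSTANT UNDER THE CELLS: Proposition 6's construction, record structure, for `(U₀″)^{h}` instead of `U₀″` — item (B′-3) of the
# plan's road (B′) for director-ym №310∕№311's branch (ii) «Landau-restoring correction»

statement-level skeleton of published theorems with citation tags; proofs where landed; nothing here is a claim about the Yang–Mills mass gap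

CITATION HEADER (lean-in-tree rule).  Cell `pub-ymgap` (HUMAN RULING D-0062), «N05-REC» road; director-ym №311 (1)(c′): pens n05-e «(B′-1) + (B′-2) now, then (B′-3) `prop6_of_thm4`
twin + (B′-5), (B′-4) last».  (B′-1) = `B8BlockConstantLiftRec` ((1.29) with data; the block-constant `g_c`), (B′-2) = `B8BlockConstantLiftStabilityRec` (the surface `InAxOneZ`, `InAk`,
(1.66) under `U′ ↦ U′^{h}`), THIS FILE = (B′-3).  Pen dag-n05-e g41.  [6] = [Balaban1985RegularSpaces] Prop. 6 (1.134)–(1.138) p. 99, (1.132)–(1.133) p. 99, Thm. 4 p. 88, (1.33)–(1.34)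
p. 82, (1.66) p. 87, (1.29) p. 81; [3] = [Balaban1985Averaging] (8), (11) pp. 18–19, Prop. 2 p. 26; [I] = [Balaban1987RG1] (0.3)–(0.4) pp. 252–253, (0.6) p. 253.
`--kind proof --supports stmt-QuantumFields-20541` (K0⁷; count-neutral; no definition).
REUSED BY NAME: `B8Prop6OfThm4Rec.{Thm4AtOneZ, Cond166CubeZ, cond166CubeZ_one_iff, localGaugeZ_mem}` + the engine algebra `B8Prop6OfThm4.{agree135, one_inAk}`,
`B8Eq131CubesRec.ineq132_cubes` ((1.132)∕(1.133) for the record), `B8Ineq133Rec.cutFixedZ`, `B8Eq115GaugeFixing.{gaugeAct_mul, gaugeAct_mem_of}`, `B8Ineq133.cutCfg_mem`,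
`B8BlockConstantLiftStabilityRec.{inAxOneZ_gaugeAct_of_blockConstant, inAk_gaugeAct_of_U1, cond166CubeZ_one_gaugeAct_of_osc}`.

THE STEP (memo `SCOPE-IIB.md` §4).  `prop6_of_thm4` feeds Theorem 4 (`Thm4AtOneZ`, `Restr` data ZERO, `Concl` abstract) the input `U₀″ = cutFixedZ …` of p. 98; here the input
is `(U₀″)^{h} = gaugeAct h U₀″` for a `G`-valued `h` CONSTANT on the block tower under every cell of `LamPZ` (levels `≥ 1`) with oscillation `≤ τ` between adjacent level-`j` blocks of
`□_j`: by (B′-2) it is still in `𝔄_k({□_j}, L³α₀)`, still ON THE RADIAL SURFACE `Ax_k(ℭ_k, 1)`, and satisfies (1.66) with `α₁ + τ`; so Theorem 4 gives EXACTLY ONE `u₀` with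
`Restr u₀ ∧ Concl (L³α₀) (6dL²Mα₀ + τ) ((U₀″)^{h}) u₀`, and (1.135) reads `U₀^{w′⁻¹} = ((U₀″)^{h})^{u₀⁻¹}` on `□̃` with `w′ := v⁻¹·h⁻¹·u₀` `G`-valued — rows 1–8 of
`HThm4RecSym152` for the representative `((U₀″)^{h})^{u₀⁻¹}` EXACTLY (whatever `Concl` the driver instantiates), the restriction data carried by `h⁻¹·u₀` (B′-1, B′-5).
WHAT IS PROVED (sorry-free).  ★★★ `prop6_of_thm4_precomposed` — `prop6_of_thm4`'s statement with the extra input `h` (hypotheses: `G`-valued; constant under the cells of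
`LamPZ L a M ρ k`, levels `1 ≤ j ≤ k`; oscillation `≤ τ` on the level-`j` bonds of `□_j^{(j)}`, `0 ≤ τ`; the threshold `L³α₀ + (6dL²Mα₀ + τ) ≤ c₁`) and the conclusion for the
pre-composed input; `prop6_of_thm4` itself is the case `h = 1`, `τ = 0` (`prop6_of_thm4_precomposed_one`).
HONEST SCOPE.  Assembly of (B′-2) with the record's (1.132)∕(1.133) and the Theorem-4 INTERFACE (a hypothesis, as in `prop6_of_thm4`); nothing of Theorem 4 proved; NO new estimate;
(B′-4) (crown re-assembly on this output) and (B′-5) (the second-order restriction-data defect of `h⁻¹·u₀`) are separate files; branch (ii) licence line as ruled («variant, our proof»);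
`HThm4Rec*` CONDITIONAL; N05 DISCHARGED OF RECORD since R467 (count-neutral record-level work), N07 NOT discharged; counts unmoved (typed 28∕28 · discharged 8∕28); one finite 𝕋⁴
programme at fixed ε, `G = SU(2)` of record — nothing continuum ∕ ℝ⁴ ∕ OS ∕ mass gap ∕ Clay.  No `def`, no `instance`, no `notation`, no `sorry`.
-/

set_option autoImplicit false

noncomputable section

namespace Literature.MathematicalPhysics.QuantumFieldTheory.Balaban1983to89.B8Prop6OfThm4PrecomposedRec

open B7Prop1Explicit B7Prop2Explicit B7Prop1Local B7AvgGaugeCovariance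
open BlockAveragingZd (avgIterZ offZ ctrShift)
open B7Prop2Rec (AvgClosedZ C0Z C0Z_pos)
open B8Ineq130Rec (tlo thi tlo_le_thi)
open B8Ineq133 (cutCfg cutCfg_mem)
open B8Ineq133Rec (cutFixedZ)
open B8Eq115GaugeFixing (gaugeAct_mem_of gaugeAct_mul)
open B8Eq115GaugeFixingRec (localGaugeZ)
open B8Ineq132 (InAk)
open B8Ineq132Rec (pdevOn_lt_of_inAk_box)
open B8Eq119TwistedAxialRec (InAxOneZ UnderZ)
open B8Eq131Cubes (tLo tHi ctr tLo_le_tHi)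
open B8Eq131CubesRec (sqLoZ sqHiZ cubeZ tcubeZ LamPZ ineq132_cubes)
open B8Prop6OfThm4 (agree135 one_inAk)
open B8Prop6OfThm4Rec (Thm4AtOneZ Cond166CubeZ cond166CubeZ_one_iff localGaugeZ_mem)
open B8BlockConstantLiftStabilityRec (inAxOneZ_gaugeAct_of_blockConstant inAk_gaugeAct_of_U1 cond166CubeZ_one_gaugeAct_of_osc)
export B7Prop1Explicit (Site)

variable {d : ℕ}
variable {𝔸 : Type*} [NormedRing 𝔸] [NormOneClass 𝔸] [NormedAlgebra ℂ 𝔸] [CompleteSpace 𝔸]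

/-- ★★★ **PROPOSITION 6's CONSTRUCTION WITH THE THEOREM-4 INPUT PRE-COMPOSED BY A BLOCK-CONSTANT GAUGE TRANSFORMATION** ([6] p. 99 for the pair `1, (U₀″)^{h}`; record structure;
road (B′) of director-ym №310∕№311).  Under `prop6_of_thm4`'s hypotheses and for a `G`-valued `h` CONSTANT on the block tower under every cell of `ℭ_k = ⋃ Λ′_j` (`LamPZ`, `1 ≤ j ≤ k`)
with `‖h_j(x) − h_j(x + e_ν)‖ ≤ τ` on the level-`j` bonds of `□_j^{(j)}` (`h_j(w) = h(Lʲ·w)`) and the threshold `L³α₀ + (6dL²Mα₀ + τ) ≤ c₁`: the pre-composed input `(U₀″)^{h}`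
satisfies (1.33)∕(1.34)∕(1.66) (it stays on the RADIAL surface `Ax_k(ℭ_k, 1)`), so Theorem 4 (`Thm4AtOneZ`, restriction data zero) yields exactly one `G`-valued `u₀` with `Restr u₀` and
`Concl (L³α₀) (6dL²Mα₀ + τ) ((U₀″)^{h}) u₀`; moreover `w′ := v⁻¹·h⁻¹·u₀` is `G`-valued and (1.135) holds in the form `U₀^{w′⁻¹} = ((U₀″)^{h})^{u₀⁻¹}` on the bonds of the centred
`□̃` (`v = localGaugeZ …` the radial gauge of p. 98). [cite: Balaban1985RegularSpaces, Prop. 6 (1.134)-(1.135) p.99, (1.132)-(1.133) p.99, Thm. 4 p.88, (1.66) p.87; Balaban1985Averaging, (8) p.18, (11) p.19; Balaban1987RG1, (0.4) p.253, (0.6) p.253] -/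
theorem prop6_of_thm4_precomposed {L s : ℕ} (hLs : L = 2 * s + 1) (hL : 2 ≤ L) (hd : 1 ≤ d) {G : Subgroup 𝔸ˣ} (hG : AvgClosedZ d L G) (k : ℕ)
    (U₀ : Site d → Fin d → 𝔸ˣ) (hU : ∀ x κ, U₀ x κ ∈ G) {α₀ : ℝ} (hα : 0 < α₀)
    (hα3 : C0Z d * (α₀ * (L : ℝ) ^ 2) ≤ 1 / 3) (hα2 : 2 * (α₀ * (L : ℝ) ^ 2) ≤ c2' d L)
    (a : Site d) {M ρ : ℕ} (hρ : 1 ≤ ρ) (hρM : ρ ≤ M) (hM : 11 * (d : ℝ) < M)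
    {η : ℝ} (hη : 0 < η) {Ω : ℕ → Set (Site d)} (hA : InAk L k η α₀ Ω U₀) (hT : tcubeZ L a M ρ k ⊆ Ω (k - 1))
    (hsmall : 11 * (d : ℝ) ^ 2 * (L : ℝ) ^ 2 * α₀ + ((M : ℝ) + 4 * ρ) * d * (L : ℝ) ^ 2 * α₀ ≤ 1 / 6)
    {c₁ : ℝ} {Restr : (Site d → 𝔸ˣ) → Prop} {Concl : ℝ → ℝ → (Site d → Fin d → 𝔸ˣ) → (Site d → 𝔸ˣ) → Prop}
    (hThm4 : Thm4AtOneZ L k η c₁ G a M ρ Restr Concl)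
    -- the pre-composition: a `G`-valued gauge transformation constant under the cells, with oscillation `≤ τ` between adjacent level-`j` blocks of `□_j`
    (h : Site d → 𝔸ˣ) (hhG : ∀ x, h x ∈ G) (X : ℕ → Site d → 𝔸ˣ)
    (hconst : ∀ j, 1 ≤ j → j ≤ k → ∀ xj ∈ LamPZ L a M ρ k j, ∀ x, UnderZ L j xj x → h x = X j xj)
    {τ : ℝ} (hτ : 0 ≤ τ)
    (hosc : ∀ j, j ≤ k → ∀ (x : Site d) (ν : Fin d), sqLoZ L a ρ k j ≤ x → x + e ν ≤ sqHiZ L a M ρ k j →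
      ‖((uLev L h j x : 𝔸ˣ) : 𝔸) - ((uLev L h j (x + e ν) : 𝔸ˣ) : 𝔸)‖ ≤ τ)
    (hc₁ : (L : ℝ) ^ 3 * α₀ + (6 * d * (L : ℝ) ^ 2 * M * α₀ + τ) ≤ c₁) :
    ∃ u₀ : Site d → 𝔸ˣ, (∀ x, u₀ x ∈ G) ∧ Restr u₀ ∧
      Concl ((L : ℝ) ^ 3 * α₀) (6 * d * (L : ℝ) ^ 2 * M * α₀ + τ)
        (gaugeAct h (cutFixedZ L (tLo a ρ) (tHi a M ρ) U₀ k (ctr a M))) u₀ ∧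
      (∀ u' : Site d → 𝔸ˣ, (∀ x, u' x ∈ G) → Restr u' →
        Concl ((L : ℝ) ^ 3 * α₀) (6 * d * (L : ℝ) ^ 2 * M * α₀ + τ)
          (gaugeAct h (cutFixedZ L (tLo a ρ) (tHi a M ρ) U₀ k (ctr a M))) u' → u' = u₀) ∧
      (∀ x, ((localGaugeZ L (tLo a ρ) (tHi a M ρ) U₀ k (ctr a M))⁻¹ * (h⁻¹ * u₀)) x ∈ G) ∧
      AgreeOn (tlo L (tLo a ρ) k) (thi L (tHi a M ρ) k)
        (gaugeAct ((localGaugeZ L (tLo a ρ) (tHi a M ρ) U₀ k (ctr a M))⁻¹ * (h⁻¹ * u₀))⁻¹ U₀)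
        (gaugeAct u₀⁻¹ (gaugeAct h (cutFixedZ L (tLo a ρ) (tHi a M ρ) U₀ k (ctr a M)))) := by
  have hL1 : 1 ≤ L := le_trans (by norm_num) hL
  have hM1 : 1 ≤ M := hρ.trans hρM
  have hLpos : (0 : ℝ) < L := by exact_mod_cast lt_of_lt_of_le (by norm_num) hL
  have hdpos : (0 : ℝ) < d := by exact_mod_cast hd
  have hMpos : (0 : ℝ) < M := by exact_mod_cast hM1
  have hLo : Odd L := ⟨s, hLs⟩
  have hα₀' : 0 < (L : ℝ) ^ 3 * α₀ := by positivity
  have hα₁' : 0 < 6 * (d : ℝ) * (L : ℝ) ^ 2 * M * α₀ + τ := by positivity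
  obtain ⟨h132a, h132b, h133⟩ := ineq132_cubes hLs hL hd hG k U₀ hU hα hα3 hα2 a hρ hρM hM hη hA hT hsmall
  have hΩ : ∃ l, l ≤ k ∧ k ≤ l + 1 ∧ ∀ x, InBox (tlo L (tLo a ρ) k) (thi L (tHi a M ρ) k) x → x ∈ Ω l :=
    ⟨k - 1, Nat.sub_le _ _, by omega, fun x hx => hT hx⟩
  have hvG : ∀ x, localGaugeZ L (tLo a ρ) (tHi a M ρ) U₀ k (ctr a M) x ∈ G :=
    localGaugeZ_mem hLs hL hG k U₀ hU hα hα3 hα2 (tLo_le_tHi hM1) (pdevOn_lt_of_inAk_box hL1 hα hA hΩ) (ctr a M)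
  have hU''G : ∀ x κ, cutFixedZ L (tLo a ρ) (tHi a M ρ) U₀ k (ctr a M) x κ ∈ G :=
    cutCfg_mem (gaugeAct_mem_of hU hvG)
  have hhU : ∀ x, h x ∈ U1 𝔸 := fun x => hG.le_U1 (hhG x)
  -- the pre-composed input: `G`-valued, in `𝔄_k`, on the radial surface, (1.66) with `α₁ + τ`
  set W : Site d → Fin d → 𝔸ˣ := gaugeAct h (cutFixedZ L (tLo a ρ) (tHi a M ρ) U₀ k (ctr a M)) with hW
  have hWG : ∀ x κ, W x κ ∈ G := gaugeAct_mem_of hU''G hhG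
  have hWk : InAk L k η ((L : ℝ) ^ 3 * α₀) (cubeZ L a M ρ k) W := inAk_gaugeAct_of_U1 L k η _ _ hhU h132a
  have hWax : InAxOneZ L k (LamPZ L a M ρ k) W := inAxOneZ_gaugeAct_of_blockConstant hLo k _ X h hconst h132b
  have h166 : Cond166CubeZ L k a M ρ (1 : Site d → Fin d → 𝔸ˣ) (cutFixedZ L (tLo a ρ) (tHi a M ρ) U₀ k (ctr a M))
      (6 * d * (L : ℝ) ^ 2 * M * α₀) :=
    (cond166CubeZ_one_iff L k a M ρ _ _).2 h133
  have hW166 : Cond166CubeZ L k a M ρ (1 : Site d → Fin d → 𝔸ˣ) W (6 * d * (L : ℝ) ^ 2 * M * α₀ + τ) :=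
    cond166CubeZ_one_gaugeAct_of_osc L k a M ρ hhU h166 hosc
  obtain ⟨u₀, ⟨huG, hR, hC⟩, huniq⟩ := hThm4 hα₀' hα₁' hc₁ W hWG (one_inAk hL1 k hη hα₀' _) hWk hWax hW166
  refine ⟨u₀, huG, hR, hC, huniq, fun x => G.mul_mem (G.inv_mem (hvG x)) (G.mul_mem (G.inv_mem (hhG x)) (huG x)), ?_⟩
  -- (1.135) for the pre-composed input: `U₀^{(v⁻¹h⁻¹u₀)⁻¹} = ((U₀″)^{h})^{u₀⁻¹}` on `□̃`
  have h135 := agree135 (tlo L (tLo a ρ) k) (thi L (tHi a M ρ) k) U₀ (localGaugeZ L (tLo a ρ) (tHi a M ρ) U₀ k (ctr a M)) (h⁻¹ * u₀)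
  have hmul : gaugeAct (h⁻¹ * u₀)⁻¹ (cutFixedZ L (tLo a ρ) (tHi a M ρ) U₀ k (ctr a M)) =
      gaugeAct u₀⁻¹ (gaugeAct h (cutFixedZ L (tLo a ρ) (tHi a M ρ) U₀ k (ctr a M))) := by
    rw [mul_inv_rev, inv_inv, gaugeAct_mul]
  rw [← hmul]
  exact h135

/-- `prop6_of_thm4` IS the case `h = 1`, `τ = 0` (sanity ∕ A6: the pre-composition hypotheses are inhabited by the trivial transformation with the constant datum `X ≡ 1`).
[cite: Balaban1985RegularSpaces, Prop. 6 p.99; Balaban1987RG1, (0.4) p.253] -/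
theorem prop6_of_thm4_precomposed_one {L s : ℕ} (hLs : L = 2 * s + 1) (hL : 2 ≤ L) (hd : 1 ≤ d) {G : Subgroup 𝔸ˣ} (hG : AvgClosedZ d L G) (k : ℕ)
    (U₀ : Site d → Fin d → 𝔸ˣ) (hU : ∀ x κ, U₀ x κ ∈ G) {α₀ : ℝ} (hα : 0 < α₀)
    (hα3 : C0Z d * (α₀ * (L : ℝ) ^ 2) ≤ 1 / 3) (hα2 : 2 * (α₀ * (L : ℝ) ^ 2) ≤ c2' d L)
    (a : Site d) {M ρ : ℕ} (hρ : 1 ≤ ρ) (hρM : ρ ≤ M) (hM : 11 * (d : ℝ) < M)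
    {η : ℝ} (hη : 0 < η) {Ω : ℕ → Set (Site d)} (hA : InAk L k η α₀ Ω U₀) (hT : tcubeZ L a M ρ k ⊆ Ω (k - 1))
    (hsmall : 11 * (d : ℝ) ^ 2 * (L : ℝ) ^ 2 * α₀ + ((M : ℝ) + 4 * ρ) * d * (L : ℝ) ^ 2 * α₀ ≤ 1 / 6)
    {c₁ : ℝ} {Restr : (Site d → 𝔸ˣ) → Prop} {Concl : ℝ → ℝ → (Site d → Fin d → 𝔸ˣ) → (Site d → 𝔸ˣ) → Prop}
    (hThm4 : Thm4AtOneZ L k η c₁ G a M ρ Restr Concl)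
    (hc₁ : (L : ℝ) ^ 3 * α₀ + (6 * d * (L : ℝ) ^ 2 * M * α₀ + 0) ≤ c₁) :
    ∃ u₀ : Site d → 𝔸ˣ, (∀ x, u₀ x ∈ G) ∧ Restr u₀ ∧
      Concl ((L : ℝ) ^ 3 * α₀) (6 * d * (L : ℝ) ^ 2 * M * α₀ + 0)
        (gaugeAct 1 (cutFixedZ L (tLo a ρ) (tHi a M ρ) U₀ k (ctr a M))) u₀ :=
  let ⟨u₀, huG, hR, hC, _⟩ := prop6_of_thm4_precomposed hLs hL hd hG k U₀ hU hα hα3 hα2 a hρ hρM hM hη hA hT hsmall hThm4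
    1 (fun _ => G.one_mem) (fun _ _ => 1) (fun _ _ _ _ _ _ _ => rfl) le_rfl
    (fun j _ x ν _ _ => by simp) hc₁
  ⟨u₀, huG, hR, hC⟩

end Literature.MathematicalPhysics.QuantumFieldTheory.Balaban1983to89.B8Prop6OfThm4PrecomposedRec
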